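import Mathlib
import Literature.MathematicalPhysics.QuantumLattice.HeatKernelGroupMeasureProofs
import Literature.MathematicalPhysics.QuantumFieldTheory.LatticeGaugeProofs
import Literature.Probability.LatticeModels.GibbsSpecificationTilted
import Literature.Probability.LatticeModels.DobrushinMetricStates
import Literature.Probability.LatticeModels.ONModelProofs
import HarnessLib

/-!
# The Gibbsian specification of a plaquette-weight lattice gauge measure on the torus

For a continuous positive single-plaquette weight `v : G → ℝ` on a compact group `G` and the
discrete torus `(ℤ/L)^d`, the plaquette-weight measure
`μ_v(dU) = Z⁻¹ ∏_q v(U_q) ∏_e dHaar(U_e)` (tree: `groupHeatKernelMeasure (fun _ => v) 0`) is the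
unique Gibbs measure of the finite-volume **torus weight specification**
`γ_Λ(dU | η) = Z_Λ(η)⁻¹ exp(∑_q log v(U_q)) (Haar^{⊗Λ} ⊗ δ_{η_{Λᶜ}})(dU)`, `Λ ⊆ edges`
(Georgii 2011, Def. 2.9 with (1.21)–(1.23): a finite system is specified by its conditional
distributions; Seiler LNP 159 Ch. 2, DLR equations of lattice gauge theories). This file records:

* `torusLogWeight v U = ∑_q log v(U_q)` and `∏_q v(U_q) = exp (torusLogWeight v U)`;
* `torusWeightSpec v` and `isSpecification_torusWeightSpec` (an instance of the generic
  `isSpecification_tilted_map_glueWith_pi`: tilting by the FULL torus energy in every volume, the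
  plaquettes away from `Λ` cancelling in the normalisation);
* `siteLaw_torusWeightSpec_eq_tilted_haar` — the one-link conditional law is the tilted Haar
  measure `Z⁻¹ exp(∑_q log v((ω^{e←g})_q)) dg`;
* `groupHeatKernelMeasure_eq_tilted`, `torusWeightSpec_univ` — in the full volume the kernel is the
  plaquette-weight measure itself, whence `isGibbsMeasure_groupHeatKernelMeasure` (DLR equations =
  consistency of the specification).

## References
* H.-O. Georgii, *Gibbs Measures and Phase Transitions*, 2nd ed. (2011), Def. 1.23, Def. 2.9.
* E. Seiler, LNP 159 (1982), Ch. 2.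
* S. Friedli, Y. Velenik, *Statistical Mechanics of Lattice Systems* (2017), §6.10.1.
-/

noncomputable section

open MeasureTheory Filter Topology Function
open Literature.Probability.LatticeModels Literature.Probability.LatticeModels.DobrushinMetric
open Literature.MathematicalPhysics.QuantumLattice

namespace Literature.MathematicalPhysics.QuantumFieldTheory

variable {d L : ℕ} {G : Type*} [Group G] [TopologicalSpace G] [IsTopologicalGroup G]
  [CompactSpace G] [MeasurableSpace G] [BorelSpace G]

/-! ### The torus energy `∑_q log v(U_q)` -/

/-- The **torus log-weight** (minus the energy) of a single-plaquette weight `v`: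
`torusLogWeight v U = ∑_q log v(U_q)` over all plaquettes of the torus `(ℤ/L)^d`.
[cite: SeilerLNP1982, Ch. 2] -/
def torusLogWeight [NeZero L] (v : G → ℝ) (U : GaugeConfig d L G) : ℝ :=
  ∑ q : Plaquette d L, Real.log (v (plaquetteHolonomy U q.1 q.2.1.1 q.2.1.2))

variable [NeZero L]

omit [MeasurableSpace G] [BorelSpace G] [CompactSpace G] in
/-- The torus log-weight of a continuous positive weight is continuous. [folklore] -/
theorem continuous_torusLogWeight {v : G → ℝ} (hv : Continuous v) (hv0 : ∀ g, 0 < v g) :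
    Continuous (torusLogWeight (d := d) (L := L) v) := by
  unfold torusLogWeight
  refine continuous_finsetSum _ fun q _ => ?_
  exact (hv.comp (continuous_plaquetteHolonomy _ _ _)).log fun U => (hv0 _).ne'

omit [CompactSpace G] in
/-- The torus log-weight of a continuous positive weight is measurable (second-countable `G`). [folklore] -/
theorem measurable_torusLogWeight [SecondCountableTopology G] {v : G → ℝ} (hv : Continuous v) :
    Measurable (torusLogWeight (d := d) (L := L) v) := by
  unfold torusLogWeight
  refine Finset.measurable_sum _ fun q _ => ?_
  exact (hv.measurable.comp (measurable_plaquetteHolonomy _ _ _)).log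

omit [MeasurableSpace G] [BorelSpace G] in
/-- The torus log-weight of a continuous positive weight is bounded (compact `G`). [folklore] -/
theorem exists_abs_torusLogWeight_le {v : G → ℝ} (hv : Continuous v) (hv0 : ∀ g, 0 < v g) :
    ∃ B, ∀ U : GaugeConfig d L G, |torusLogWeight v U| ≤ B := by
  obtain ⟨C, hC⟩ := isCompact_univ.exists_bound_of_continuousOn
    (continuous_torusLogWeight (d := d) (L := L) hv hv0).continuousOn
  exact ⟨C, fun U => by simpa [Real.norm_eq_abs] using hC U (Set.mem_univ U)⟩

omit [TopologicalSpace G] [IsTopologicalGroup G] [CompactSpace G] [MeasurableSpace G] [BorelSpace G] in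
/-- `∏_q v(U_q) = exp (∑_q log v(U_q))` for a positive weight: the plaquette-weight density is the
exponential of the torus log-weight. [folklore] -/
theorem groupHeatKernelWeight_eq_exp_torusLogWeight {v : G → ℝ} (hv0 : ∀ g, 0 < v g)
    (U : GaugeConfig d L G) :
    groupHeatKernelWeight (d := d) (L := L) (fun _ : ℝ => v) 0 U = Real.exp (torusLogWeight v U) := by
  simp only [groupHeatKernelWeight, torusLogWeight, Real.exp_sum, Real.exp_log (hv0 _)]

/-! ### The torus weight specification -/

/-- The **torus weight specification** of the single-plaquette weight `v` on the edges of
`(ℤ/L)^d`: `γ_Λ(· | η) = (Haar^{⊗Λ} ⊗ δ_{η_{Λᶜ}}).tilted (∑_q log v(U_q))` — product Haar measure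
on the links of `Λ`, glued with `η` off `Λ`, tilted by the full torus energy (the plaquettes not
meeting `Λ` cancel in the normalisation, so this is the usual Gibbs kernel with boundary
condition `η`) (Georgii 2011, Def. 2.9; Seiler LNP 159 Ch. 2). [cite: Georgii2011, Def. 2.9] -/
def torusWeightSpec (v : G → ℝ) : Specification (Edge d L) G :=
  fun Λ η => ((Measure.pi fun _ : ↥Λ => haarProbability G).map (glueWith Λ · η)).tilted
    (torusLogWeight v)

/-- **The torus weight specification is a specification** (probability kernels, outside
measurability, properness, consistency) — the generic Gibbsian-specification theorem
`isSpecification_tilted_map_glueWith_pi` with the volume-independent energy `∑_q log v(U_q)`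
(Georgii 2011, Def. 2.9 with Def. 1.23; Friedli–Velenik 2017, §6.10.1). [cite: Georgii2011, Def. 2.9] -/
theorem isSpecification_torusWeightSpec [SecondCountableTopology G] [MeasurableSingletonClass G]
    {v : G → ℝ} (hv : Continuous v) (hv0 : ∀ g, 0 < v g) :
    IsSpecification (torusWeightSpec (d := d) (L := L) v) := by
  haveI : NeZero (haarProbability G) := ⟨IsProbabilityMeasure.ne_zero _⟩
  obtain ⟨B, hB⟩ := exists_abs_torusLogWeight_le (d := d) (L := L) hv hv0
  exact isSpecification_tilted_map_glueWith_pi (V := Edge d L) (S := G) (haarProbability G)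
    (φ := fun _ => torusLogWeight v) (fun _ => measurable_torusLogWeight hv)
    (fun _ => ⟨B, hB⟩) (fun _ _ _ σ σ' _ => by simp)

/-! ### The one-link conditional law -/

/-- **The one-link conditional law of the torus weight specification is a tilted Haar measure**:
the law of `U_e` under `γ_{e}(· | ω)` is `Z⁻¹ exp(∑_q log v((ω^{e ← g})_q)) dg` (Haar `dg`)
(Seiler LNP 159 Ch. 2; cf. `siteLaw_ymSpecification_eq_tilted_haar` for the Wilson action on
`ℤ^d`). [cite: SeilerLNP1982, Ch. 2] -/
theorem siteLaw_torusWeightSpec_eq_tilted_haar [SecondCountableTopology G] [DecidableEq (Edge d L)]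
    {v : G → ℝ} (hv : Continuous v) (e : Edge d L) (ω : GaugeConfig d L G) :
    siteLaw (torusWeightSpec v) e ω =
      (haarProbability G).tilted fun g => torusLogWeight v (Function.update ω e g) := by
  have hF : Measurable (torusLogWeight (d := d) (L := L) v) := measurable_torusLogWeight hv
  -- the kernel at `{e}` as a push-forward of the tilted one-fold product
  have h1 : torusWeightSpec v {e} ω =
      ((Measure.pi fun _ : ↥({e} : Finset (Edge d L)) => haarProbability G).tilted
        (torusLogWeight v ∘ fun ζ => glueWith {e} ζ ω)).map (fun ζ => glueWith {e} ζ ω) := by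
    unfold torusWeightSpec
    rw [map_tilted_comp _ (measurable_glueWith _ ω) hF]
  have hgl : (fun ζ : ↥({e} : Finset (Edge d L)) → G => glueWith {e} ζ ω) =
      Function.update ω e ∘ fun ζ => ζ ⟨e, Finset.mem_singleton_self e⟩ := by
    funext ζ z
    by_cases hz : z = e
    · subst hz
      simp
    · rw [Function.comp_apply, Function.update_of_ne hz,
        glueWith_apply_not_mem _ _ _ (by simpa using hz)]
  have hev : (Measure.pi fun _ : ↥({e} : Finset (Edge d L)) => haarProbability G).map
      (fun ζ => ζ ⟨e, Finset.mem_singleton_self e⟩) = haarProbability G :=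
    (MeasureTheory.measurePreserving_eval (fun _ : ↥({e} : Finset (Edge d L)) =>
      haarProbability G) ⟨e, Finset.mem_singleton_self e⟩).map_eq
  have hF' : Measurable fun g : G => torusLogWeight v (Function.update ω e g) :=
    hF.comp (measurable_update ω)
  have key := map_tilted_comp (Measure.pi fun _ : ↥({e} : Finset (Edge d L)) => haarProbability G)
    (measurable_pi_apply (⟨e, Finset.mem_singleton_self e⟩ : ↥({e} : Finset (Edge d L)))) hF'
  rw [hev] at key
  rw [siteLaw, h1, Measure.map_map (measurable_pi_apply e) (measurable_glueWith _ ω), hgl]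
  have hcomp : (torusLogWeight v ∘ Function.update ω e ∘ fun ζ : ↥({e} : Finset (Edge d L)) → G =>
        ζ ⟨e, Finset.mem_singleton_self e⟩) =
      (fun g => torusLogWeight v (Function.update ω e g)) ∘
        fun ζ : ↥({e} : Finset (Edge d L)) → G => ζ ⟨e, Finset.mem_singleton_self e⟩ := rfl
  have hcomp' : ((fun σ : GaugeConfig d L G => σ e) ∘ Function.update ω e ∘
      fun ζ : ↥({e} : Finset (Edge d L)) → G => ζ ⟨e, Finset.mem_singleton_self e⟩) =
      fun ζ : ↥({e} : Finset (Edge d L)) → G => ζ ⟨e, Finset.mem_singleton_self e⟩ := by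
    funext ζ; simp
  rw [hcomp, hcomp']
  exact key

/-! ### The full volume: the plaquette-weight measure and the DLR equations -/

/-- Gluing on the full volume is the reindexing `ζ ↦ (e ↦ ζ ⟨e, _⟩)`; it pushes the product Haar
measure on `G^{univ}` to the product Haar measure on `G^{edges}`. [folklore] -/
theorem map_glueWith_univ_pi (η : GaugeConfig d L G) :
    (Measure.pi fun _ : ↥(Finset.univ : Finset (Edge d L)) => haarProbability G).map
        (glueWith Finset.univ · η) =
      Measure.pi fun _ : Edge d L => haarProbability G := by
  let f : ↥(Finset.univ : Finset (Edge d L)) ≃ Edge d L :=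
    ⟨fun x => x.1, fun e => ⟨e, Finset.mem_univ e⟩, fun x => by simp, fun e => rfl⟩
  have hglue : (fun ζ : ↥(Finset.univ : Finset (Edge d L)) → G => glueWith Finset.univ ζ η) =
      MeasurableEquiv.piCongrLeft (fun _ : Edge d L => G) f := by
    funext ζ e
    rw [glueWith_apply_mem _ _ _ (Finset.mem_univ e), MeasurableEquiv.coe_piCongrLeft,
      Equiv.piCongrLeft_apply_eq_cast]
    rfl
  rw [hglue]
  exact (measurePreserving_piCongrLeft (fun _ : Edge d L => haarProbability G) f).map_eq

/-- **The plaquette-weight torus measure is the Haar tilt by the torus log-weight**: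
`Z⁻¹ ∏_q v(U_q) ∏_e dU_e = (∏_e dU_e).tilted (∑_q log v(U_q))`. [cite: SeilerLNP1982, Ch. 2] -/
theorem groupHeatKernelMeasure_eq_tilted [SecondCountableTopology G] {v : G → ℝ} (hv : Continuous v)
    (hv0 : ∀ g, 0 < v g) :
    groupHeatKernelMeasure (d := d) (L := L) (fun _ : ℝ => v) 0 =
      (Measure.pi fun _ : Edge d L => haarProbability G).tilted (torusLogWeight v) := by
  set π : Measure (GaugeConfig d L G) := Measure.pi fun _ : Edge d L => haarProbability G with hπ
  have hW : (fun U : GaugeConfig d L G =>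
      ENNReal.ofReal (groupHeatKernelWeight (d := d) (L := L) (fun _ : ℝ => v) 0 U)) =
      fun U => ENNReal.ofReal (Real.exp (torusLogWeight v U)) := by
    funext U; rw [groupHeatKernelWeight_eq_exp_torusLogWeight hv0]
  have hcont : Continuous fun U : GaugeConfig d L G => Real.exp (torusLogWeight v U) :=
    Real.continuous_exp.comp (continuous_torusLogWeight hv hv0)
  have hmeas : Measurable fun U : GaugeConfig d L G => ENNReal.ofReal (Real.exp (torusLogWeight v U)) :=
    ENNReal.measurable_ofReal.comp hcont.measurable
  obtain ⟨C, hC⟩ := isCompact_univ.exists_bound_of_continuousOn hcont.continuousOn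
  have hint : Integrable (fun U : GaugeConfig d L G => Real.exp (torusLogWeight v U)) π :=
    Integrable.of_bound hcont.measurable.aestronglyMeasurable C
      (Eventually.of_forall fun U => hC U (Set.mem_univ U))
  have hZpos : 0 < ∫ U, Real.exp (torusLogWeight v U) ∂π := by
    haveI : IsProbabilityMeasure π := by rw [hπ]; infer_instance
    exact integral_exp_pos hint
  have huniv : (π.withDensity fun U => ENNReal.ofReal (Real.exp (torusLogWeight v U))) Set.univ =
      ENNReal.ofReal (∫ U, Real.exp (torusLogWeight v U) ∂π) := by
    rw [withDensity_apply _ MeasurableSet.univ, Measure.restrict_univ,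
      ofReal_integral_eq_lintegral_ofReal hint (Eventually.of_forall fun U => (Real.exp_pos _).le)]
  rw [groupHeatKernelMeasure_eq, hW, huniv, Measure.tilted]
  have hdens : (fun U : GaugeConfig d L G => ENNReal.ofReal (Real.exp (torusLogWeight v U) /
        ∫ U, Real.exp (torusLogWeight v U) ∂π)) =
      (ENNReal.ofReal (∫ U, Real.exp (torusLogWeight v U) ∂π))⁻¹ •
        fun U => ENNReal.ofReal (Real.exp (torusLogWeight v U)) := by
    funext U
    rw [Pi.smul_apply, smul_eq_mul, ENNReal.ofReal_div_of_pos hZpos, div_eq_mul_inv, mul_comm]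
  rw [hdens, withDensity_smul _ hmeas]

/-- **In the full volume the torus weight kernel is the plaquette-weight measure**, whatever the
boundary condition: `γ_{edges}(· | η) = μ_v`. [cite: Georgii2011, Def. 2.9] -/
theorem torusWeightSpec_univ [SecondCountableTopology G] {v : G → ℝ} (hv : Continuous v)
    (hv0 : ∀ g, 0 < v g) (η : GaugeConfig d L G) :
    torusWeightSpec v Finset.univ η = groupHeatKernelMeasure (d := d) (L := L) (fun _ : ℝ => v) 0 := by
  rw [groupHeatKernelMeasure_eq_tilted hv hv0, torusWeightSpec, map_glueWith_univ_pi]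

/-- **DLR equations on the torus**: the plaquette-weight measure `μ_v` is a Gibbs measure of the
torus weight specification — for a finite system the DLR equation in the volume `Λ` is the
consistency `γ_{edges} γ_Λ = γ_{edges}` of the specification (Georgii 2011, Def. 1.23 with
Remark (1.24); Seiler LNP 159 Ch. 2). [cite: Georgii2011, Def. 1.23 / Rem. 1.24] -/
theorem isGibbsMeasure_groupHeatKernelMeasure [SecondCountableTopology G] [MeasurableSingletonClass G]
    {v : G → ℝ} (hv : Continuous v) (hv0 : ∀ g, 0 < v g) :
    IsGibbsMeasure (torusWeightSpec (d := d) (L := L) v)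
      (groupHeatKernelMeasure (d := d) (L := L) (fun _ : ℝ => v) 0) := by
  classical
  have hγ := isSpecification_torusWeightSpec (d := d) (L := L) hv hv0
  obtain ⟨η⟩ : Nonempty (GaugeConfig d L G) := ⟨fun _ => 1⟩
  rw [← torusWeightSpec_univ hv hv0 η]
  refine ⟨hγ.isProbability _ _, fun Λ A hA => ?_⟩
  exact hγ.consistent (Finset.subset_univ Λ) η A hA

end Literature.MathematicalPhysics.QuantumFieldTheory
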